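import Mathlib
import HarnessLib
import Summits.NavierStokesRegularity.NavierStokesRegularity.Theorems.PoloidalWindowDoorLrcModEntireJetCertMasked

/-!
# Route `PoloidalWindowDoor`, item `LrcModEntire` (stmt-NavierStokesRegularity-20428) — CERTIFICATE TREES: branching on pins
# (Thomas-decomposition style) for the kernel-side elimination checker

Cell ns-regularity-ideate, seat ns-poloidal-K2-p3 gen 7 (lead of item 20428; `--supports stmt-NavierStokesRegularity-20428`; definitions reviewed).
Fourth file of the checker (`…JetCertDefs`, `…JetCertMasked`, `…JetLetters`).  An exact elimination of a PDE system is a TREE: at a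
node one either closes by a certificate whose final law is a product of powers of the PINS known to be non-zero at the base point
(pseudo-division style: leading coefficients are MULTIPLIED in, never inverted — so no inverse letters are needed and the jet map stays
fixed), or one SPLITS on a new polynomial `π` of the letters: on the branch «`π ≠ 0` at a (moved) base point» `π` joins the pins, on
the branch «`π ≡ 0` near the base point» `π` joins the hypothesis laws.  The dichotomy is elementary (no identity theorem): either
`π ∘ g` vanishes on a neighbourhood of `p₀`, or every neighbourhood of `p₀` — in particular the open set where the current pins are
non-zero — contains a point `p₁` with `π(g p₁) ≠ 0`, and all data (open set, tables, laws, pins) restrict/move.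

* `powQ`, `pinProduct` (+ `ev_powQ`, `ev_pinProduct`) — monomials in the pins as term lists;
* `CertTree` (`leaf cert k e` / `split π nz z`), `checkTree` — ONE Boolean, by structural recursion (`decide +kernel`);
* `LocalDatum n S M v hyps pins` — «there are an open `U ∋ p₀`, a differentiable jet map `g` on `U` with the (masked) tables
  `S`/`M` along the directions `v`, all `hyps` vanishing on `U` along `g`, all `pins` non-zero at `g p₀`»;
* `not_localDatum_of_checkTree` — SOUNDNESS: `checkTree … t = true → ¬ LocalDatum …` (induction on the tree; leaves by
  `…JetCertMasked.cert_contradictionM`).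
So a consumer (the (TH) wiring of `stub_localTHEmpty`, next file) builds ONE `LocalDatum` from the stub's analytic data with
`hyps` = the four local laws (+ commutation laws) and `pins` = {twist, μ, μ − 1, ∂_zμ}, and any engine's exported tree closes it.

WHAT THIS IS NOT: not a claim about Navier–Stokes and not a certificate — the checker (bears_on LADDER-NS N0, item 20428 `stub_localTHEmpty`).
References: J. M. Thomas, *Differential Systems* (1937); Ritt (1950) Ch. I (characteristic sets; initials multiplied in). [folklore]
-/

noncomputable section

-- the summit and its single sub-problem share the name (CONVENTIONS §1), as in every Theorems file
set_option linter.dupNamespace false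

namespace Summit.NavierStokesRegularity.NavierStokesRegularity.Theorems.PoloidalWindowDoorLrcModEntireJetCertTree

open _root_.Topology _root_.Filter Set
open Literature.Analysis.ValidatedNumerics Literature.Analysis.ValidatedNumerics.QMvPoly
open Literature.Analysis.Calculus.MvPoly
open Summit.NavierStokesRegularity.NavierStokesRegularity.Theorems.PoloidalWindowDoorLrcModEntireJetCertDefs
open Summit.NavierStokesRegularity.NavierStokesRegularity.Theorems.PoloidalWindowDoorLrcModEntireJetCertMasked

variable {E : Type*} [NormedAddCommGroup E] [NormedSpace ℝ E] {n : ℕ}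

/-! ### Monomials in the pins -/

/-- Powers of a term list by repeated multiplication (`p⁰ = 1`). [folklore] -/
def powQ (p : QMvPoly) : ℕ → QMvPoly
  | 0 => QMvPoly.const 1
  | k + 1 => QMvPoly.mul p (powQ p k)

/-- `ev (p^k) = (ev p)^k`. [folklore] -/
theorem ev_powQ (p : QMvPoly) (z : EuclideanSpace ℝ (Fin n)) : ∀ k : ℕ, ev n (powQ p k) z = (ev n p z) ^ k := by
  intro k
  induction k with
  | zero => simp [powQ, ev, QMvPoly.toMv_const, toFun_apply]
  | succ k ih => rw [powQ, ev_mul, ih, pow_succ, mul_comm]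

/-- The monomial `Πᵢ pinsᵢ ^ eᵢ` in a list of pins (missing exponents read as absent factors). [folklore] -/
def pinProduct : List QMvPoly → List ℕ → QMvPoly
  | [], _ => QMvPoly.const 1
  | _ :: _, [] => QMvPoly.const 1
  | π :: ps, e :: es => QMvPoly.mul (powQ π e) (pinProduct ps es)

/-- A monomial in pins that are non-zero at a point is non-zero there. [folklore] -/
theorem ev_pinProduct_ne_zero (z : EuclideanSpace ℝ (Fin n)) :
    ∀ (pins : List QMvPoly) (es : List ℕ), (∀ π ∈ pins, ev n π z ≠ 0) → ev n (pinProduct pins es) z ≠ 0 := by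
  intro pins
  induction pins with
  | nil => intro es _; simp [pinProduct, ev, QMvPoly.toMv_const, toFun_apply]
  | cons π ps ih =>
    intro es hne
    cases es with
    | nil => simp [pinProduct, ev, QMvPoly.toMv_const, toFun_apply]
    | cons e es =>
      rw [pinProduct, ev_mul, ev_powQ]
      exact mul_ne_zero (pow_ne_zero _ (hne π (by simp))) (ih es fun π' h => hne π' (by simp [h]))

/-! ### Certificate trees and the Boolean checker -/

/-- A certificate TREE: a `leaf cert k e` closes the current node by the masked certificate `cert` whose `k`-th derived law must be
the pin monomial with exponents `e`; a `split π nz z` branches on the polynomial `π` (non-zero branch `nz`: `π` becomes a pin;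
zero branch `z`: `π` becomes a hypothesis law). [folklore] -/
inductive CertTree : Type
  | leaf : List (List (QMvPoly × ℕ × List ℕ)) → ℕ → List ℕ → CertTree
  | split : QMvPoly → CertTree → CertTree → CertTree

/-- The recursive Boolean check of a certificate tree against hypothesis laws and pins. [folklore] -/
def checkTree (n : ℕ) (S : ℕ → ℕ → QMvPoly) (M : ℕ → ℕ → Bool) : List QMvPoly → List QMvPoly → CertTree → Bool
  | hyps, pins, .leaf cert k e => certCheckM n S M hyps cert k (pinProduct pins e)
  | hyps, pins, .split π nz z => checkTree n S M hyps (pins ++ [π]) nz && checkTree n S M (hyps ++ [π]) pins z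

/-! ### Local data and soundness -/

/-- **A LOCAL DATUM** for hypothesis laws `hyps` and pins `pins`: an open `U ∋ p₀`, a jet map `g` differentiable on `U` whose tabled
letters have the derivative tables `S j` along the directions `v j` on `U`, every hypothesis law vanishing on `U` along `g`, every pin
non-zero at `g p₀`. [folklore] -/
def LocalDatum (n : ℕ) (S : ℕ → ℕ → QMvPoly) (M : ℕ → ℕ → Bool) (v : ℕ → E) (hyps pins : List QMvPoly) : Prop :=
  ∃ (U : Set E) (p₀ : E) (g : E → EuclideanSpace ℝ (Fin n)), IsOpen U ∧ p₀ ∈ U ∧ (∀ x ∈ U, DifferentiableAt ℝ g x) ∧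
    (∀ j, ∀ i : Fin n, M j i = true → ∀ x ∈ U, fderiv ℝ (fun y => g y i) x (v j) = ev n (S j i) (g x)) ∧
    (∀ L ∈ hyps, ∀ x ∈ U, ev n L (g x) = 0) ∧ (∀ π ∈ pins, ev n π (g p₀) ≠ 0)

/-- `x ↦ π(g x)` is continuous at points of differentiability of `g`. [folklore] -/
theorem continuousAt_ev_comp {g : E → EuclideanSpace ℝ (Fin n)} {x : E} (hg : DifferentiableAt ℝ g x) (π : QMvPoly) :
    ContinuousAt (fun y => ev n π (g y)) x :=
  ((differentiable_toFun (QMvPoly.toMv ℝ n π)).continuous.continuousAt).comp hg.continuousAt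

/-- **SOUNDNESS OF CERTIFICATE TREES.**  A tree that checks refutes every local datum. [folklore] -/
theorem not_localDatum_of_checkTree {S : ℕ → ℕ → QMvPoly} {M : ℕ → ℕ → Bool} {v : ℕ → E} :
    ∀ (t : CertTree) (hyps pins : List QMvPoly), checkTree n S M hyps pins t = true → ¬ LocalDatum n S M v hyps pins := by
  intro t
  induction t with
  | leaf cert k e =>
    intro hyps pins hcheck hdat
    obtain ⟨U, p₀, g, hU, hp₀, hg, hS, hhyps, hpins⟩ := hdat
    simp only [checkTree] at hcheck
    exact cert_contradictionM hU hg hS hhyps hcheck hp₀ (ev_pinProduct_ne_zero (g p₀) pins e hpins)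
  | split π nz z ihnz ihz =>
    intro hyps pins hcheck hdat
    simp only [checkTree, Bool.and_eq_true] at hcheck
    obtain ⟨hc1, hc2⟩ := hcheck
    obtain ⟨U, p₀, g, hU, hp₀, hg, hS, hhyps, hpins⟩ := hdat
    by_cases hzero : ∃ V : Set E, IsOpen V ∧ p₀ ∈ V ∧ ∀ x ∈ V, ev n π (g x) = 0
    · -- zero branch: `π` becomes a hypothesis law on `U ∩ V`
      obtain ⟨V, hV, hp₀V, hπ⟩ := hzero
      refine ihz (hyps ++ [π]) pins hc2 ⟨U ∩ V, p₀, g, hU.inter hV, ⟨hp₀, hp₀V⟩, fun x hx => hg x hx.1,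
        fun j i hi x hx => hS j i hi x hx.1, ?_, hpins⟩
      intro L hL x hx
      rcases List.mem_append.1 hL with h | h
      · exact hhyps L h x hx.1
      · rw [List.mem_singleton.1 h]; exact hπ x hx.2
    · -- non-zero branch: move the base point inside the open set where the current pins are non-zero
      push Not at hzero
      set N : Set E := U ∩ ⋂ π' ∈ pins, {x | ev n π' (g x) ≠ 0} with hN
      -- `N` is a neighbourhood of `p₀`
      have hNnhds : N ∈ 𝓝 p₀ := by
        refine Filter.inter_mem (hU.mem_nhds hp₀) ?_
        refine (Filter.biInter_mem (List.finite_toSet pins)).2 fun π' hπ' => ?_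
        exact (continuousAt_ev_comp (hg p₀ hp₀) π').eventually_ne (hpins π' hπ')
      obtain ⟨V, hVN, hVo, hp₀V⟩ := mem_nhds_iff.1 hNnhds
      obtain ⟨p₁, hp₁V, hp₁⟩ := hzero V hVo hp₀V
      have hp₁N : p₁ ∈ N := hVN hp₁V
      refine ihnz hyps (pins ++ [π]) hc1 ⟨U, p₁, g, hU, hp₁N.1, hg, hS, hhyps, ?_⟩
      intro π' hπ'
      rcases List.mem_append.1 hπ' with h | h
      · have := (Set.mem_iInter₂.1 hp₁N.2) π' h
        exact this
      · rw [List.mem_singleton.1 h]; exact hp₁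

/-! ### Self-test (`decide +kernel`): a split on an auxiliary pin

Letters `u, u′, u″` as in `…JetCertMasked.example_checkM` (`u‴` untabled is not needed); hypothesis `u·u′ = 0` (so either factor
vanishes); pins: `u`.  Split on `π = u′`: on the branch `u′ ≠ 0` the leaf certificate `1·(u u′)` has final law `u·u′` = the pin
monomial `u¹·(u′)¹`; on the branch `u′ ≡ 0` the law `u′` is a hypothesis, differentiate it: `u″`... and with the extra hypothesis
`u″ − u = 0` the leaf `−(u″ − u) + u″ = u` is the pin monomial `u¹`. -/

/-- The self-test tree checks. [folklore] -/
theorem example_checkTree :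
    checkTree 3 exampleTableM exampleMaskM
      [QMvPoly.mul (QMvPoly.var 3 0) (QMvPoly.var 3 1), QMvPoly.var 3 2 ++ QMvPoly.smul (-1) (QMvPoly.var 3 0)]
      [QMvPoly.var 3 0]
      (.split (QMvPoly.var 3 1)
        (.leaf [[(QMvPoly.const 1, 0, [])]] 2 [1, 1])
        (.leaf [[(QMvPoly.const 1, 2, [0])], [(QMvPoly.const (-1), 1, []), (QMvPoly.const 1, 3, [])]] 4 [1])) = true := by
  decide +kernel

end Summit.NavierStokesRegularity.NavierStokesRegularity.Theorems.PoloidalWindowDoorLrcModEntireJetCertTree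

end
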